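import Summits.Ventures.PercRepro.C041ZonePortSub

/-!
# The zone port problem of THEOREM R: CASE (v) — the unique one-edge gate zone, the pattern correspondence and the
transfer of the predicates (p6, gen 24)

Setting of `C041ZonePortSub` (mine-3, C-041.md §3 (v) / §6 (c)).  The port-free reach `R₀` has a UNIQUE gate zone
`C`, switchable, carrying a SINGLE terminal edge `e*`, a 1-edge.  A pattern `x` of `P` is a pattern `x′` of the
sub-problem `P.sub C hC` together with the colour `b = x e*` (`restrict` / `extend`, the equivalence `patternEquiv`).
The dictionary: with `e*` red, `Good₂ x` holds (the red gate edge, THE KEY FACT) and `Good₁ x ↔ Good₁′ x′`; with `e*`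
blue, `Good₁ x` fails (`R₀` has no endpoint and the only exit is deleted) and `Good₂ x ↔ Good₂′ x′`; admissibility
and the validity data `X₂` transfer, `X₁ x` holds when `e*` is red.  The sums are in `C041ZonePortCaseVSum`.
-/

namespace PercRepro

namespace ZonePort

namespace Problem

open Finset

variable {V E : Type*} [DecidableEq V] {P : Problem V E} {C : Finset V}

/-- A term of the sub-problem is a term of `P`. -/
def liftTerm (P : Problem V E) (C : Finset V) (hC : C ∈ P.Z) (e : (P.sub C hC).Term) : P.Term :=
  ⟨e.1, Finset.mem_of_mem_erase e.2⟩

/-- The restriction of a pattern of `P` to the sub-problem. -/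
def restrict (P : Problem V E) (C : Finset V) (hC : C ∈ P.Z) (x : P.Term → Bool) : (P.sub C hC).Term → Bool :=
  fun e => x (P.liftTerm C hC e)

/-- The extension of a pattern of the sub-problem by the colour `b` at the gate zone. -/
def extend (P : Problem V E) (C : Finset V) (hC : C ∈ P.Z) (x' : (P.sub C hC).Term → Bool) (b : Bool) :
    P.Term → Bool :=
  fun e => if h : P.tz e.1 = C then b else x' ⟨e.1, Finset.mem_erase.2 ⟨h, e.2⟩⟩

/-- The zone of a term of the sub-problem is not the gate zone. -/
theorem liftTerm_tz_ne (hC : C ∈ P.Z) (e : (P.sub C hC).Term) : P.tz (P.liftTerm C hC e).1 ≠ C :=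
  (Finset.mem_erase.1 e.2).1

/-- The extension agrees with the sub-problem's pattern off the gate zone. -/
@[simp] theorem extend_liftTerm (hC : C ∈ P.Z) (x' : (P.sub C hC).Term → Bool) (b : Bool)
    (e : (P.sub C hC).Term) : P.extend C hC x' b (P.liftTerm C hC e) = x' e := by
  unfold extend
  rw [dif_neg (liftTerm_tz_ne hC e)]
  rfl

/-- The extension has the colour `b` at the gate zone's edges. -/
theorem extend_of_tz (hC : C ∈ P.Z) (x' : (P.sub C hC).Term → Bool) (b : Bool) {e : P.Term}
    (he : P.tz e.1 = C) : P.extend C hC x' b e = b := by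
  unfold extend
  exact dif_pos he

/-- The extension off the gate zone, unfolded. -/
theorem extend_of_ne (hC : C ∈ P.Z) (x' : (P.sub C hC).Term → Bool) (b : Bool) {e : P.Term}
    (he : P.tz e.1 ≠ C) : P.extend C hC x' b e = x' ⟨e.1, Finset.mem_erase.2 ⟨he, e.2⟩⟩ := by
  unfold extend
  exact dif_neg he

/-- Restricting an extension gives the pattern back. -/
theorem restrict_extend (hC : C ∈ P.Z) (x' : (P.sub C hC).Term → Bool) (b : Bool) :
    P.restrict C hC (P.extend C hC x' b) = x' := by
  funext e
  exact extend_liftTerm hC x' b e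

/-- Extending a restriction by the pattern's own colour at the unique gate edge gives the pattern back. -/
theorem extend_restrict (hC : C ∈ P.Z) {e₀ : P.Term} (huniqT : ∀ f : P.Term, P.tz f.1 = C → f = e₀)
    (x : P.Term → Bool) : P.extend C hC (P.restrict C hC x) (x e₀) = x := by
  funext e
  by_cases he : P.tz e.1 = C
  · rw [extend_of_tz hC _ _ he, huniqT e he]
  · rw [extend_of_ne hC _ _ he]
    rfl

/-- **The pattern correspondence**: a pattern of `P` is a pattern of the sub-problem with a colour at the unique
gate edge. -/
def patternEquiv (hC : C ∈ P.Z) (e₀ : P.Term) (huniqT : ∀ f : P.Term, P.tz f.1 = C → f = e₀) :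
    (P.Term → Bool) ≃ ((P.sub C hC).Term → Bool) × Bool where
  toFun x := (P.restrict C hC x, x e₀)
  invFun q := P.extend C hC q.1 q.2
  left_inv x := extend_restrict hC huniqT x
  right_inv q := by
    obtain ⟨x', b⟩ := q
    have he₀ : P.tz e₀.1 = C := by
      obtain ⟨e, he⟩ := P.hk C hC
      have := huniqT ⟨e, he ▸ hC⟩ he
      rw [← this]
      exact he
    simp only [restrict_extend, extend_of_tz hC x' b he₀]

/-! ### Transfer of the predicates along `extend` -/

section Transfer

variable (hC : P.IsGate C) (huniq : ∀ D, P.IsGate D → D = C) {e₀ : P.Term} (he₀ : P.tz e₀.1 = C)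
  (hs₀ : P.ts e₀.1 = false) (huniqT : ∀ f : P.Term, P.tz f.1 = C → f = e₀) (hsw : P.sw C = true)

omit [DecidableEq V] in
include hs₀ huniqT in
/-- The gate zone carries 1-edges only. -/
theorem pure₁_of_uniqT : P.Pure₁ C := fun f hf => (huniqT f hf) ▸ hs₀

omit [DecidableEq V] in
include hs₀ huniqT in
/-- A 2-edge is not at the gate zone. -/
theorem tz_ne_of_two {f : P.Term} (hf : P.ts f.1 = true) : P.tz f.1 ≠ C := by
  intro h
  have := pure₁_of_uniqT hs₀ huniqT f h
  rw [hf] at this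
  exact Bool.noConfusion this

/-- The gate zone is disjoint from the sub-problem's port vertices. -/
theorem gate_disjoint_sub_PV (hCZ : C ∈ P.Z) : ∀ v ∈ C, v ∉ (P.sub C hCZ).PV := by
  rintro v hv ⟨D, hD, hvD⟩
  exact P.hdisj D (Finset.mem_of_mem_erase hD) C hCZ (Finset.mem_erase.1 hD).1 v hvD hv

include hs₀ huniqT in
/-- `A₂` transfers (the gate zone has no 2-edge). -/
theorem A₂_extend (hCZ : C ∈ P.Z) (x' : (P.sub C hCZ).Term → Bool) (b : Bool) :
    P.A₂ (P.extend C hCZ x' b) = (P.sub C hCZ).A₂ x' := by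
  ext v
  constructor
  · rintro ⟨e, he, hxe, hve⟩
    have hne : P.tz e.1 ≠ C := tz_ne_of_two hs₀ huniqT he
    refine ⟨⟨e.1, Finset.mem_erase.2 ⟨hne, e.2⟩⟩, he, ?_, hve⟩
    rw [extend_of_ne hCZ x' b hne] at hxe
    exact hxe
  · rintro ⟨e, he, hxe, hve⟩
    refine ⟨P.liftTerm C hCZ e, he, ?_, hve⟩
    rw [extend_liftTerm]
    exact hxe

/-- `A₁` transfers off the gate zone. -/
theorem mem_A₁_extend_iff (hCZ : C ∈ P.Z) (x' : (P.sub C hCZ).Term → Bool) (b : Bool) {v : V} (hv : v ∉ C) :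
    v ∈ P.A₁ (P.extend C hCZ x' b) ↔ v ∈ (P.sub C hCZ).A₁ x' := by
  constructor
  · rintro ⟨e, he, hxe, hve⟩
    have hne : P.tz e.1 ≠ C := fun h => hv (h ▸ hve)
    refine ⟨⟨e.1, Finset.mem_erase.2 ⟨hne, e.2⟩⟩, he, ?_, hve⟩
    rw [extend_of_ne hCZ x' b hne] at hxe
    exact hxe
  · rintro ⟨e, he, hxe, hve⟩
    refine ⟨P.liftTerm C hCZ e, he, ?_, hve⟩
    rw [extend_liftTerm]
    exact hxe

/-- With the gate edge red, the gate zone is not deleted on side `1`. -/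
theorem gate_not_mem_A₁_of_red (hCZ : C ∈ P.Z) (x' : (P.sub C hCZ).Term → Bool) :
    ∀ v ∈ C, v ∉ P.A₁ (P.extend C hCZ x' true) := by
  rintro v hv ⟨e, _, hxe, hve⟩
  by_cases he : P.tz e.1 = C
  · rw [extend_of_tz hCZ x' true he] at hxe
    exact Bool.noConfusion hxe
  · exact P.hdisj C hCZ (P.tz e.1) e.2 (Ne.symm he) v hv hve

include he₀ hs₀ in
/-- With the gate edge blue, the gate zone is deleted on side `1`. -/
theorem gate_mem_A₁_of_blue (hCZ : C ∈ P.Z) (x' : (P.sub C hCZ).Term → Bool) :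
    ∀ v ∈ C, v ∈ P.A₁ (P.extend C hCZ x' false) :=
  fun _ hv => ⟨e₀, hs₀, extend_of_tz hCZ x' false he₀, he₀ ▸ hv⟩

/-- With the gate edge red, `A₁` is the sub-problem's `A₁` (the gate zone is in neither). -/
theorem A₁_extend_true (hCZ : C ∈ P.Z) (x' : (P.sub C hCZ).Term → Bool) :
    P.A₁ (P.extend C hCZ x' true) = (P.sub C hCZ).A₁ x' := by
  ext v
  by_cases hv : v ∈ C
  · constructor
    · intro h
      exact absurd h (gate_not_mem_A₁_of_red hCZ x' v hv)
    · intro h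
      exact absurd (A₁_subset x' h) (gate_disjoint_sub_PV hCZ v hv)
  · exact mem_A₁_extend_iff hCZ x' true hv

include hC huniq hs₀ huniqT in
/-- **`Good₁` transfers when the gate edge is red.** -/
theorem good₁_extend_true_iff (x' : (P.sub C hC.mem).Term → Bool) :
    P.Good₁ (P.extend C hC.mem x' true) ↔ (P.sub C hC.mem).Good₁ x' := by
  rw [Good₁, Good₁, A₁_extend_true]
  constructor
  · rintro ⟨e, he, hxe, hr⟩
    have hne : P.tz e.1 ≠ C := tz_ne_of_two hs₀ huniqT he
    refine ⟨⟨e.1, Finset.mem_erase.2 ⟨hne, e.2⟩⟩, he, ?_, ?_⟩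
    · rw [extend_of_ne hC.mem x' true hne] at hxe
      exact hxe
    · exact (reach_iff_reach_sub hC huniq ((A₁_subset x').trans (sub_PV_subset hC.mem))
        (fun v hv hvA => gate_disjoint_sub_PV hC.mem v hv (A₁_subset x' hvA))
        (not_mem_R₀_of_mem_zone e.2 (P.htv e.1))).1 hr
  · rintro ⟨e, he, hxe, hr⟩
    refine ⟨P.liftTerm C hC.mem e, he, ?_, ?_⟩
    · rw [extend_liftTerm]
      exact hxe
    · exact (reach_iff_reach_sub hC huniq ((A₁_subset x').trans (sub_PV_subset hC.mem))
        (fun v hv hvA => gate_disjoint_sub_PV hC.mem v hv (A₁_subset x' hvA))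
        (not_mem_R₀_of_mem_zone (Finset.mem_of_mem_erase e.2) (P.htv e.1))).2 hr

include hC he₀ hs₀ huniqT in
/-- **`Good₂` holds when the gate edge is red.** -/
theorem good₂_extend_true (x' : (P.sub C hC.mem).Term → Bool) : P.Good₂ (P.extend C hC.mem x' true) :=
  good₂_of_red_pure_gate (e := e₀) (he₀ ▸ hC) hs₀ (he₀ ▸ pure₁_of_uniqT hs₀ huniqT)
    (extend_of_tz hC.mem x' true he₀)

include hC huniq he₀ hs₀ in
/-- **`Good₁` fails when the gate edge is blue.** -/
theorem not_good₁_extend_false (x' : (P.sub C hC.mem).Term → Bool) :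
    ¬ P.Good₁ (P.extend C hC.mem x' false) := by
  rintro ⟨e, _, _, hr⟩
  exact not_reach_of_gate_mem huniq (gate_mem_A₁_of_blue he₀ hs₀ hC.mem x')
    (not_mem_R₀_of_mem_zone e.2 (P.htv e.1)) hr

include hC huniq hs₀ huniqT in
/-- **`Good₂` transfers when the gate edge is blue.** -/
theorem good₂_extend_false_iff (x' : (P.sub C hC.mem).Term → Bool) :
    P.Good₂ (P.extend C hC.mem x' false) ↔ (P.sub C hC.mem).Good₂ x' := by
  rw [Good₂, Good₂, A₂_extend hs₀ huniqT]
  have hCA : ∀ v ∈ C, v ∉ (P.sub C hC.mem).A₂ x' :=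
    fun v hv hvA => gate_disjoint_sub_PV hC.mem v hv (A₂_subset x' hvA)
  constructor
  · rintro ⟨e, he, hxe, hr⟩
    have hne : P.tz e.1 ≠ C := by
      intro h
      rw [extend_of_tz hC.mem x' false h] at hxe
      exact Bool.noConfusion hxe
    refine ⟨⟨e.1, Finset.mem_erase.2 ⟨hne, e.2⟩⟩, he, ?_, ?_⟩
    · rw [extend_of_ne hC.mem x' false hne] at hxe
      exact hxe
    · exact (reach_iff_reach_sub hC huniq ((A₂_subset x').trans (sub_PV_subset hC.mem)) hCA
        (not_mem_R₀_of_mem_zone e.2 (P.htv e.1))).1 hr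
  · rintro ⟨e, he, hxe, hr⟩
    refine ⟨P.liftTerm C hC.mem e, he, ?_, ?_⟩
    · rw [extend_liftTerm]
      exact hxe
    · exact (reach_iff_reach_sub hC huniq ((A₂_subset x').trans (sub_PV_subset hC.mem)) hCA
        (not_mem_R₀_of_mem_zone (Finset.mem_of_mem_erase e.2) (P.htv e.1))).2 hr

include hs₀ huniqT in
/-- `X₂` transfers (the gate zone has no 2-edge). -/
theorem X₂_extend_iff (hCZ : C ∈ P.Z) (x' : (P.sub C hCZ).Term → Bool) (b : Bool) :
    P.X₂ (P.extend C hCZ x' b) ↔ (P.sub C hCZ).X₂ x' := by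
  constructor
  · rintro ⟨e, he, hxe⟩
    have hne : P.tz e.1 ≠ C := tz_ne_of_two hs₀ huniqT he
    refine ⟨⟨e.1, Finset.mem_erase.2 ⟨hne, e.2⟩⟩, he, ?_⟩
    rw [extend_of_ne hCZ x' b hne] at hxe
    exact hxe
  · rintro ⟨e, he, hxe⟩
    exact ⟨P.liftTerm C hCZ e, he, by rw [extend_liftTerm]; exact hxe⟩

include he₀ hs₀ in
/-- `X₁` holds when the gate edge is red. -/
theorem X₁_extend_true (hCZ : C ∈ P.Z) (x' : (P.sub C hCZ).Term → Bool) :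
    P.X₁ (P.extend C hCZ x' true) :=
  ⟨e₀, hs₀, extend_of_tz hCZ x' true he₀⟩

/-- `X₁` transfers when the gate edge is blue. -/
theorem X₁_extend_false_iff (hCZ : C ∈ P.Z) (x' : (P.sub C hCZ).Term → Bool) :
    P.X₁ (P.extend C hCZ x' false) ↔ (P.sub C hCZ).X₁ x' := by
  constructor
  · rintro ⟨e, he, hxe⟩
    have hne : P.tz e.1 ≠ C := by
      intro h
      rw [extend_of_tz hCZ x' false h] at hxe
      exact Bool.noConfusion hxe
    refine ⟨⟨e.1, Finset.mem_erase.2 ⟨hne, e.2⟩⟩, he, ?_⟩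
    rw [extend_of_ne hCZ x' false hne] at hxe
    exact hxe
  · rintro ⟨e, he, hxe⟩
    exact ⟨P.liftTerm C hCZ e, he, by rw [extend_liftTerm]; exact hxe⟩

include hs₀ huniqT hsw in
/-- Admissibility transfers (the gate zone is switchable and carries a single 1-edge). -/
theorem adm_extend_iff (hCZ : C ∈ P.Z) (x' : (P.sub C hCZ).Term → Bool) (b : Bool) :
    P.Adm (P.extend C hCZ x' b) ↔ (P.sub C hCZ).Adm x' := by
  constructor
  · rintro ⟨h1, h2⟩
    refine ⟨fun e he => ?_, fun e f hef he hf => ?_⟩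
    · have := h1 (P.liftTerm C hCZ e) he
      rw [extend_liftTerm] at this
      exact this
    · have := h2 (P.liftTerm C hCZ e) (P.liftTerm C hCZ f) hef he hf
      rw [extend_liftTerm, extend_liftTerm] at this
      exact this
  · rintro ⟨h1, h2⟩
    refine ⟨fun e he => ?_, fun e f hef he hf => ?_⟩
    · by_cases hep : P.tz e.1 = C
      · rw [hep] at he
        rw [he] at hsw
        exact Bool.noConfusion hsw
      · rw [extend_of_ne hCZ x' b hep]
        exact h1 ⟨e.1, Finset.mem_erase.2 ⟨hep, e.2⟩⟩ he
    · have hfp : P.tz f.1 ≠ C := tz_ne_of_two hs₀ huniqT hf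
      have hep : P.tz e.1 ≠ C := by rw [hef]; exact hfp
      rw [extend_of_ne hCZ x' b hep, extend_of_ne hCZ x' b hfp]
      exact h2 ⟨e.1, Finset.mem_erase.2 ⟨hep, e.2⟩⟩ ⟨f.1, Finset.mem_erase.2 ⟨hfp, f.2⟩⟩ hef he hf

end Transfer

end Problem

end ZonePort

end PercRepro
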